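import Summits.CriticalPhenomena.SAWScalingLimit.Theses.SAWConePseudogroup
import Summits.CriticalPhenomena.SAWScalingLimit.Theses.SAWConfRestriction
import Summits.CriticalPhenomena.SAWScalingLimit.Theses.SAWBrownianDomination
import Summits.CriticalPhenomena.SAWScalingLimit.Theses.SAWTowerCount
import Summits.CriticalPhenomena.SAWScalingLimit.Theses.SAWTensorRG
import Summits.CriticalPhenomena.SAWScalingLimit.Theses.SAWExpCovariance
import Summits.CriticalPhenomena.SAWScalingLimit.Theorems.SAWTensorRGRestrictionOfLimitStubRestrictionOfSqueeze
import Summits.CriticalPhenomena.SAWScalingLimit.Theorems.SAWTensorRGRestrictionOfLimitStubRadoSqueezeFamily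

/-!
# `RestrictionOfLimit` from `DiscContinuity`: LSW's restriction property of the SAW scaling limit reduces to
# domain continuity in the Radó sense

Support file (`--supports stmt-CriticalPhenomena-0773`, registered stub `stub_restrictionOfLimitOfDiscContinuity`)
of the line `birth` for the crux `RestrictionOfLimit` (stmt-CriticalPhenomena-0773; shared verbatim by the routes
SAWConePseudogroup / SAWConfRestriction / SAWBrownianDomination / SAWTowerCount / SAWTensorRG). It is the
sorry-free composition 3 of the registered skeleton `Cruxes/RestrictionOfLimit/Lines/birth.lean`:

  `DiscContinuity` (stmt-CriticalPhenomena-6755, route SAWExpCovariance) `→ RestrictionOfLimit`.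

That is: IF the scaling limit `P` of the critical square-lattice SAW is continuous in the domain in the
Radó/Fréchet sense (closed-disc uniformizers `Φ_n → Φ` uniformly on the closed unit disc ⇒ `P D_n ⇒ P D` weakly),
THEN `P` has Lawler–Schramm–Werner's two-sided restriction property for EVERY pair of Dobrushin domains `D' ⊆ D`
with the same marked points: `P D' (T) · P D {γ ⊆ cl D'} = P D (T ∩ {γ ⊆ cl D'})` for all Borel `T`
(LSW, *On the scaling limit of planar self-avoiding walk* (2004) §3.4.5, "Hence, the limit measure, assuming it
exists, must satisfy this property" — here made a theorem modulo domain continuity, with no hull / smoothness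
proviso on `D'`).

Ingredients, all LANDED in this namespace: GENERIC RESTRICTION (`stub_restrictionOffCountable`, p151626: by the exact
lattice identity, domination and interior avoidance, the identity fails for at most countably many members of any
separated family of intermediate domains — their touching events are pairwise disjoint); the GLUE
`stub_restrictionOfSqueeze` (p154640: a separated exhausting outer squeeze `E t ↓ D'` inside `D` along which
`P (E t) ⇒ P D'` forces the identity, by continuity from above and uniqueness of weak limits); the RADÓ SQUEEZE
`stub_radoSqueezeFamily` (p167791: plane topology — Newman cross-cuts, Schoenflies charts, Carathéodory, Radó —
every pair admits such a squeeze together with closed-disc uniformizers converging uniformly on the closed disc).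
This file adds the passage from `DiscContinuity` (sequences) to weak continuity along the filter `𝓝[>] 0`
(`tendsto_integral_of_discContinuity`) and assembles the five route copies.

No named fact is used; axioms `propext`, `Classical.choice`, `Quot.sound`. The result is CONDITIONAL on the open
crux `DiscContinuity` (taken as an explicit hypothesis, by name).
-/

noncomputable section

open MeasureTheory Filter Topology Set Metric
open scoped ENNReal NNReal BoundedContinuousFunction
open Literature.Probability.RandomPlanarGeometry Literature.Probability.LatticeModels

namespace Summit.CriticalPhenomena.SAWScalingLimit.Theorems.RestrictionOfLimit.Birth

/-- **Outer continuity from `DiscContinuity`.** If `DiscContinuity` (stmt-CriticalPhenomena-6755) holds, then along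
a Radó squeeze (closed-disc uniformizers `Φt t → Φ` uniformly on the closed disc as `t → 0⁺`, with the marked points
at `∓1`) the laws `P (E t)` of a scaling-limit family converge weakly to `P D'` as `t → 0⁺`. Proof: sequential
characterisation of limits along the countably generated filter `𝓝[>] 0` (`Filter.tendsto_iff_seq_tendsto`); a
sequence tending to `0⁺` is eventually positive, and is made positive everywhere without changing the limit; then
`DiscContinuity` applies to `D_n = E (t_n)`, `Φ_n = Φt (t_n)`. [folklore] -/
theorem tendsto_integral_of_discContinuity
    (hDC : Summit.CriticalPhenomena.SAWScalingLimit.Theses.SAWExpCovariance.DiscContinuity)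
    {P : ChordalFamily} (hP : SAW.IsScalingLimitFamily P) {D' : DobrushinDomain} {E : ℝ → DobrushinDomain}
    {Φt : ℝ → C(ℂ, ℂ)} {Φ : C(ℂ, ℂ)}
    (hΦt : ∀ t : ℝ, 0 < t → ∃ g : ConformalEquiv (Metric.ball (0 : ℂ) 1) (E t).carrier,
      Set.EqOn (Φt t) g (Metric.ball (0 : ℂ) 1))
    (hΦ : ∃ g : ConformalEquiv (Metric.ball (0 : ℂ) 1) D'.carrier, Set.EqOn Φ g (Metric.ball (0 : ℂ) 1))
    (hmk : ∀ t : ℝ, 0 < t → (E t).pt 0 = Φt t (-1) ∧ (E t).pt 1 = Φt t 1)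
    (h0 : D'.pt 0 = Φ (-1)) (h1 : D'.pt 1 = Φ 1)
    (hunif : TendstoUniformlyOn (fun t => ((Φt t : C(ℂ, ℂ)) : ℂ → ℂ)) (Φ : ℂ → ℂ) (𝓝[>] (0 : ℝ))
      (Metric.closedBall (0 : ℂ) 1))
    (f : CurveClass ℂ →ᵇ ℝ) :
    Tendsto (fun t : ℝ => ∫ γ, f γ ∂(P (E t))) (𝓝[>] (0 : ℝ)) (𝓝 (∫ γ, f γ ∂(P D'))) := by
  rw [Filter.tendsto_iff_seq_tendsto]
  intro u hu
  -- the sequence is eventually positive; make it positive everywhere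
  have hu_pos : ∀ᶠ n in atTop, 0 < u n :=
    (hu.eventually (eventually_mem_nhdsWithin (a := (0 : ℝ)) (s := Ioi 0))).mono fun n hn => hn
  set u' : ℕ → ℝ := fun n => if 0 < u n then u n else 1 with hu'_def
  have hu'_pos : ∀ n, 0 < u' n := fun n => by
    simp only [hu'_def]
    split_ifs with h
    · exact h
    · exact one_pos
  have hu'_eq : ∀ᶠ n in atTop, u' n = u n := hu_pos.mono fun n hn => by simp [hu'_def, hn]
  have hu' : Tendsto u' atTop (𝓝[>] (0 : ℝ)) := hu.congr' (hu'_eq.mono fun n hn => hn.symm)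
  -- `DiscContinuity` along `u'`
  have hunif' : TendstoUniformlyOn (fun n => ((Φt (u' n) : C(ℂ, ℂ)) : ℂ → ℂ)) (Φ : ℂ → ℂ) atTop
      (Metric.closedBall (0 : ℂ) 1) := by
    rw [Metric.tendstoUniformlyOn_iff] at hunif ⊢
    intro ε hε
    exact hu'.eventually (hunif ε hε)
  have key := hDC P hP.1 hP.2 (fun n => E (u' n)) D' (fun n => Φt (u' n)) Φ
    (fun n => hΦt (u' n) (hu'_pos n)) hΦ (fun n => hmk (u' n) (hu'_pos n)) h0 h1 hunif' f
  refine key.congr' (hu'_eq.mono fun n hn => ?_)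
  simp only [Function.comp_apply, hn]

/-- **Registered stub `stub_restrictionOfLimitOfDiscContinuity` — `DiscContinuity → RestrictionOfLimit`.** If the
scaling limit of the critical `δℤ²` SAW is continuous in the domain in the Radó sense (the crux `DiscContinuity`,
stmt-CriticalPhenomena-6755, taken as a hypothesis by name), then it has LSW's two-sided restriction property for all
Dobrushin `D' ⊆ D` with the same marked points (the crux `RestrictionOfLimit`, stmt-CriticalPhenomena-0773, in its
SAWConfRestriction copy). Proof: the Radó squeeze of `(D, D')` (`stub_radoSqueezeFamily`), weak continuity of `P`
along it (`tendsto_integral_of_discContinuity`), and the glue `stub_restrictionOfSqueeze` (generic restriction off a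
countable set + continuity from above + uniqueness of weak limits). A CONDITIONAL result: it credits nothing to
stmt-0773 until stmt-6755 is proved. [folklore] -/
theorem stub_restrictionOfLimitOfDiscContinuity :
    Summit.CriticalPhenomena.SAWScalingLimit.Theses.SAWExpCovariance.DiscContinuity →
      Summit.CriticalPhenomena.SAWScalingLimit.Theses.SAWConfRestriction.RestrictionOfLimit := by
  intro hDC P hch hlim D D' hsub h0 h1 T hTm
  have hP : SAW.IsScalingLimitFamily P := ⟨hch, hlim⟩
  obtain ⟨E, hN, hS, hX, Φt, Φ, hΦt, hΦ, hmk, h0', h1', hunif⟩ := stub_radoSqueezeFamily D D' hsub h0 h1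
  exact stub_restrictionOfSqueeze P hP D D' E hN hS hX
    (fun f => tendsto_integral_of_discContinuity hDC hP hΦt hΦ hmk h0' h1' hunif f) T hTm

/-- `DiscContinuity → RestrictionOfLimit`, SAWConePseudogroup copy (r7; syntactically identical body). [folklore] -/
theorem restrictionOfLimit_conePseudogroup_of_discContinuity
    (hDC : Summit.CriticalPhenomena.SAWScalingLimit.Theses.SAWExpCovariance.DiscContinuity) :
    Summit.CriticalPhenomena.SAWScalingLimit.Theses.SAWConePseudogroup.RestrictionOfLimit :=
  stub_restrictionOfLimitOfDiscContinuity hDC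

/-- `DiscContinuity → RestrictionOfLimit`, SAWBrownianDomination copy (r5). [folklore] -/
theorem restrictionOfLimit_brownianDomination_of_discContinuity
    (hDC : Summit.CriticalPhenomena.SAWScalingLimit.Theses.SAWExpCovariance.DiscContinuity) :
    Summit.CriticalPhenomena.SAWScalingLimit.Theses.SAWBrownianDomination.RestrictionOfLimit :=
  stub_restrictionOfLimitOfDiscContinuity hDC

/-- `DiscContinuity → RestrictionOfLimit`, SAWTowerCount copy (support). [folklore] -/
theorem restrictionOfLimit_towerCount_of_discContinuity
    (hDC : Summit.CriticalPhenomena.SAWScalingLimit.Theses.SAWExpCovariance.DiscContinuity) :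
    Summit.CriticalPhenomena.SAWScalingLimit.Theses.SAWTowerCount.RestrictionOfLimit :=
  stub_restrictionOfLimitOfDiscContinuity hDC

/-- `DiscContinuity → RestrictionOfLimit`, SAWTensorRG copy (r5). [folklore] -/
theorem restrictionOfLimit_tensorRG_of_discContinuity
    (hDC : Summit.CriticalPhenomena.SAWScalingLimit.Theses.SAWExpCovariance.DiscContinuity) :
    Summit.CriticalPhenomena.SAWScalingLimit.Theses.SAWTensorRG.RestrictionOfLimit :=
  stub_restrictionOfLimitOfDiscContinuity hDC

/-- **Corollary: under `DiscContinuity`, the SAW scaling limit is a restriction family** in the sense of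
`ChordalFamily.IsRestriction` (the Literature predicate inlined by the route files). [folklore] -/
theorem isRestriction_of_discContinuity
    (hDC : Summit.CriticalPhenomena.SAWScalingLimit.Theses.SAWExpCovariance.DiscContinuity)
    {P : ChordalFamily} (hP : SAW.IsScalingLimitFamily P) : P.IsRestriction :=
  fun D D' hsub h0 h1 T hT => stub_restrictionOfLimitOfDiscContinuity hDC P hP.1 hP.2 D D' hsub h0 h1 T hT

end Summit.CriticalPhenomena.SAWScalingLimit.Theorems.RestrictionOfLimit.Birth

end
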